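import Mathlib
import HarnessLib
import Summits.HubbardSuperconductivity.HubbardSuperconductivity.Theorems.WeakCouplingBCSKlShellVolumeTPm03
import Summits.HubbardSuperconductivity.HubbardSuperconductivity.Theorems.WeakCouplingBCSKlLindhardKernelL2Chart
import Summits.HubbardSuperconductivity.HubbardSuperconductivity.Theorems.WeakCouplingBCSKlCertTPrimeLevelSetNull

/-!
# Route `WeakCouplingBCS` — certificate half of stmt-HubbardSuperconductivity-0158, item «(E2)-TPRIME-LINDHARD-BOUND» (pen (R460)(A)):
# the (δ) cell's `χ₀` HILBERT–SCHMIDT ROW FROM A CHART AND A TORUS-SUBLEVEL ESTIMATE ONLY — (SV) and the null level set are now THEOREMS at `t′ = −3/10`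

Cell `gate-hubbard-kl`, seat p4 (g23); zero kit; no definitions.  Composition of the generic route `klg_memLp_kernel_of_geometry` (✓ …KlLindhardKernelL2Chart) with the two
discharged inputs at the (δ) cell: the shell-volume estimate `kltp_shellVolume_m03` (✓ …KlShellVolumeTPm03, small `t`; extended to all `t` here by `vol BZ = 4π²`) and the
null level set `kltp_volume_levelSet` (✓ …KlCertTPrimeLevelSetNull).
* `volume_brillouinZone_le` — `vol BZ ≤ 4π²`; `kltp_shellVolume_m03_all` — (SV) for EVERY `t > 0` with `C_sh = 500π²`, `μ ∈ [−1, −9/10]`;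
* **`kltp_m03_HS_of_chart_TSL`** — for `μ ∈ [−1, −9/10]`: a continuous chart `γ` with `σ ≤ w₁ • γ_* dθ` ((N1)) and the torus sublevel estimate (TSL) for `ε_{−3/10}` along `γ`
  ((N3)) give `MemLp (fun z => χ₀[ε_{−3/10}](z.1 + z.2; μ)) 2 (σ ⊗ σ)` — the hypothesis `hHS` of `kltp_pocket_analytic_of_HS` / `kltp_window_U_of_HS`.
So the (δ) record's analytic residual is EXACTLY (N1) + (N3) (+ (E4) the enclosures).  Nothing here asserts (N1)/(N3), a margin, `K₃`, `U₀`, the window or superconductivity. [folklore]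
-/

noncomputable section

-- the tree's namespace `Summit.<Summit>.<Problem>.Theorems` repeats the summit name by design (D-0017)
set_option linter.dupNamespace false

namespace Summit.HubbardSuperconductivity.HubbardSuperconductivity.Theorems

open Real Set MeasureTheory MeasureTheory.Measure Literature.MathematicalPhysics.QuantumLattice
open scoped ENNReal

/-- `vol BZ ≤ 4π²` (the Brillouin zone is the preimage of `[−π,π)²` under the volume-preserving coordinate map). [folklore] -/
theorem volume_brillouinZone_le : volume brillouinZone ≤ ENNReal.ofReal (4 * π ^ 2) := by
  have hpre : brillouinZone = (fun k : Momentum => ((k 0, k 1) : ℝ × ℝ)) ⁻¹' (Ico (-π) π ×ˢ Ico (-π) π) := by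
    ext k; simp [brillouinZone, Fin.forall_fin_two, mem_prod]
  rw [hpre, measurePreserving_momentum_prod.measure_preimage (measurableSet_Ico.prod measurableSet_Ico).nullMeasurableSet]
  rw [show (volume : Measure (ℝ × ℝ)) = (volume : Measure ℝ).prod volume from rfl, Measure.prod_prod, Real.volume_Ico,
    ← ENNReal.ofReal_mul (by linarith [Real.pi_pos])]
  refine ENNReal.ofReal_le_ofReal (le_of_eq ?_)
  ring

/-- **(SV) at the (δ) cell for every `t > 0`**: `vol(BZ ∩ {|ε_{−3/10} − μ| < t}) ≤ 500π²·t` (`μ ∈ [−1, −9/10]`). [folklore] -/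
theorem kltp_shellVolume_m03_all {μ : ℝ} (hμ1 : -1 ≤ μ) (hμ2 : μ ≤ -9 / 10) (t : ℝ) (ht0 : 0 < t) :
    volume (brillouinZone ∩ {p : Momentum | |squareDispersion 1 (-3 / 10) p - μ| < t}) ≤ ENNReal.ofReal (500 * π ^ 2 * t) := by
  have hπ1 : (1 : ℝ) ≤ π := by linarith [Real.pi_gt_three]
  rcases le_or_gt t (1 / 125) with ht1 | ht1
  · refine (kltp_shellVolume_m03 hμ1 hμ2 ht0 ht1).trans (ENNReal.ofReal_le_ofReal ?_)
    have hs : (1 : ℝ) / 4 ≤ Real.sqrt (1 - (19 / 20) ^ 2) := by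
      rw [show (1 : ℝ) / 4 = Real.sqrt ((1 / 4) ^ 2) by rw [Real.sqrt_sq (by norm_num)]]
      exact Real.sqrt_le_sqrt (by norm_num)
    have hs0 : 0 < Real.sqrt (1 - (19 / 20 : ℝ) ^ 2) := lt_of_lt_of_le (by norm_num) hs
    rw [div_le_iff₀ hs0]
    have hπt : 0 < π * t := mul_pos Real.pi_pos ht0
    have : 4 * π * (5 * t) ≤ 500 * π ^ 2 * t * (1 / 4) := by nlinarith [mul_nonneg (sub_nonneg.2 hπ1) hπt.le]
    exact this.trans (mul_le_mul_of_nonneg_left hs (by positivity))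
  · calc volume (brillouinZone ∩ {p : Momentum | |squareDispersion 1 (-3 / 10) p - μ| < t})
        ≤ volume brillouinZone := measure_mono inter_subset_left
      _ ≤ ENNReal.ofReal (4 * π ^ 2) := volume_brillouinZone_le
      _ ≤ ENNReal.ofReal (500 * π ^ 2 * t) := ENNReal.ofReal_le_ofReal (by nlinarith [Real.pi_pos])

/-- **THE (δ) CELL'S HILBERT–SCHMIDT ROW FROM (N1) + (N3) ONLY**: for `μ ∈ [−1, −9/10]`, a continuous chart `γ` dominating the Fermi-curve measure of `ε_{−3/10}` and the torus
sublevel estimate along `γ` give `χ₀[ε_{−3/10}](· + ·; μ) ∈ L²(σ ⊗ σ)` ((SV) = `kltp_shellVolume_m03_all`, null level set = `kltp_volume_levelSet`).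
[cite: SteinSingularIntegrals1970, App. A.1] -/
theorem kltp_m03_HS_of_chart_TSL {μ : ℝ} (hμ1 : -1 ≤ μ) (hμ2 : μ ≤ -9 / 10) {γ : ℝ → Momentum} (hγ : Continuous γ) {w₁ C β : ℝ}
    (hσ : fermiCurveMeasure (squareDispersion 1 (-3 / 10)) μ ≤ ENNReal.ofReal w₁ • Measure.map γ (volume.restrict (Ioc (-π) π)))
    (hC : 0 ≤ C) (hβ0 : 0 < β) (hβ2 : β < 2)
    (hTSL : ∀ (p : Momentum) (s : ℝ), 0 < s →
      ((volume.restrict (Ioc (-π) π)).prod (volume.restrict (Ioc (-π) π)))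
        {z : ℝ × ℝ | |squareDispersion 1 (-3 / 10) (p + (γ z.1 + γ z.2)) - μ| < s} ≤ ENNReal.ofReal (C * s ^ β)) :
    MemLp (fun z : Momentum × Momentum => lindhardFunction (squareDispersion 1 (-3 / 10)) μ (z.1 + z.2)) 2
      ((fermiCurveMeasure (squareDispersion 1 (-3 / 10)) μ).prod (fermiCurveMeasure (squareDispersion 1 (-3 / 10)) μ)) :=
  klg_memLp_kernel_of_geometry (continuous_squareDispersion 1 (-3 / 10)) hγ μ hσ hC hβ0 hβ2 (by positivity : (0 : ℝ) ≤ 500 * π ^ 2) hTSL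
    (fun t ht => kltp_shellVolume_m03_all hμ1 hμ2 t ht) (kltp_volume_levelSet (-3 / 10) (by rw [abs_of_neg (by norm_num)]; norm_num) μ)

end Summit.HubbardSuperconductivity.HubbardSuperconductivity.Theorems

end
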